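import Summits.CriticalPhenomena.PercolationContinuityZ3.Theses.PercNearOneGluing
import Literature.Probability.Percolation.PercolationEvents
import HarnessLib.Audit
import Summits.CriticalPhenomena.PercolationContinuityZ3.Theorems.PercNearOneGluingNearOneGluingVariants2415

/-! TTRL-lite variant V2488 of stmt-CriticalPhenomena-4574

(`stub_shorteningStep` of line `kn_shortening_induction`, move `specialise+small_case`:
`n := 8` and `A.card ≤ 2`).  This variant is the specialisation at `n = 8` of the already-landed
sibling variant V2415 (`A.card ≤ 2`, any `n`, `stub_shorteningStep_var2415`), which is
Kozma–Nitzan's shortening step (Conjecture 6 of arXiv:2401.12397, measured against the minimiser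
`a₀` of the uncontracted graph) for at most two relays; see the docstring of V2415 for the
transport / Harris / mixed Kozma–Nitzan Lemma 3 argument.  No new definitions, no named facts,
the displayed induction hypothesis is not used. -/

namespace Summit.CriticalPhenomena.PercolationContinuityZ3.Theorems

open MeasureTheory Set Literature.Probability.LatticeModels Literature.Probability.Percolation
open scoped Classical BigOperators

/-- TTRL-lite variant V2488 of `stub_shorteningStep` (stmt-CriticalPhenomena-4574, Kozma–Nitzan
Conjecture 6 with the induction hypothesis displayed): the shortening step
`μ(⋃ a ∈ A, v ↔ a) · μ(a₀ ↔ b) ≤ μ(v ↔ b)` for the glued measure `μ = prodBernoulli (w[s(v,x) ↦ 1])`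
on `Fin 8`, for relay sets with `A.card ≤ 2`.  Immediate from the sibling variant
`stub_shorteningStep_var2415` (case `A.card ≤ 2`, any `n`) at `n = 8`. -/
theorem stub_shorteningStep_var2488 : ∀ (w : Sym2 (Fin 8) → unitInterval) (A : Finset (Fin 8)) (b v x a₀ : Fin 8), A.card ≤ 2 → v ∉ A → v ≠ x → w s(v, x) = 0 → a₀ ∈ A → (∀ a ∈ A, (prodBernoulli w).real (openConn a₀ b) ≤ (prodBernoulli w).real (openConn a b)) → (∀ w' : Sym2 (Fin 8) → unitInterval, (∀ e, w e = 0 → w' e = 0) → ∀ (A' : Finset (Fin 8)) (o' b' : Fin 8) (t : ℝ), (∀ a ∈ A', t ≤ (prodBernoulli w').real (openConn a b')) → (prodBernoulli w').real (⋃ a ∈ A', openConn o' a) * t ≤ (prodBernoulli w').real (openConn o' b')) → (prodBernoulli (Function.update w s(v, x) 1)).real (⋃ a ∈ A, openConn v a) * (prodBernoulli (Function.update w s(v, x) 1)).real (openConn a₀ b) ≤ (prodBernoulli (Function.update w s(v, x) 1)).real (openConn v b) :=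
  stub_shorteningStep_var2415 8

end Summit.CriticalPhenomena.PercolationContinuityZ3.Theorems
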